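import Summits.QuantumFields.BalabanUV.Beta.D1BFx.NeedleGhostBubble2PointwiseOpen
import Summits.QuantumFields.BalabanUV.Beta.D1BFx.NeedleGhostBubble2Row
import Summits.QuantumFields.BalabanUV.Beta.D1BFx.GhostLegBlockMass

/-!
# `BalabanUV.Beta.D1BFx.NeedleGhostBubble2RowMass8` — road «BF-x» for binder row D1, slot (K), END row `hGrp gN` (NEEDLES ∪ G_R), (N-2) row «T₆-ii»:
# THE GHOST BUBBLE ROW `h₆` (`qA ⊗ qA` over `Ggh`) MODULO ONE UNITS LINE `|ωgh n·cQ n·cQ n| ≤ k·n⁸` — TOLERANCE `n⁸` (the record's «NT-6» `h₆_of_scaling` has `n⁴`):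
# the mixed placements re-routed SUP ↦ (bond marginal M7 at a fixed leg site) × (block-column mass M10), constant `C₆ := k·cG·(cG + cNear)·(1 + 4∕δ_u)²·K₄(δ_u∕2)` n-FREE

HONEST DEPENDENCY (cell records, verbatim): «continuum YM on T⁴ ⇐ BetaPertH ∧ nine spine estimates (0/9 proved); BetaPertH ⇐ (D1) ∧ (D4) ∧
CAP+tail; G-an2-4 gates asym, D1 and NE2/3/4.»  HONEST FRAMING (cell contract, verbatim): «discharging `BetaPertH` makes Bałaban's UV stability
UNCONDITIONAL — a real constructive-QFT result; it is NOT the continuum limit and NOT the Clay problem.»  THIS MODULE DISCHARGES NOTHING of the wall: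
it is [folklore] lattice bookkeeping BY NAME over PART 1 `NeedleGhostBubble2PointwiseOpen.abs_biBubble_qAntiAt_qAntiAt_le_open` (the four-placement bound with the
mixed contractions OPEN), the tree's leg letters `BlockColumnSupNorm.abs_gq_le_sup` (signed block sums, `cG 4 a`, rate `δ_u`, n-FREE) and M10
`GhostLegBlockMass.sum_B_abs_Ggh_le` (block-row |·|-mass `cNear a`, hypothesis-free; columns by `Ggh_symm`), the bond marginal M7 AT A FIXED SITE
`NeedleBondMarginal.sum_bond_abs_qJetAt_le_of_root` (`(n−1)·n⁻⁴`), and my lineage's «NT-6» bookkeeping `NeedleGhostBubble2Row.abs_fullSum_weight_le_of_blockDecay_mass` ∕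
`sum_B_jetMass_le` ∕ `sum_resSite_jetMass_le`.  No `def`, no `def … : Prop`, nothing cited, 0 sorry.  THE ONLY DISPLAYED LETTER is the scalar UNITS inequality
`|ωgh n·(cQ n·cQ n)| ≤ k·n⁸` — END-AGNOSTIC (no `hω`, no `s`, no END-ii name): at the END of record's ray (reading (i)) `|ωgh·cQ²| = 4N²a²·n⁴` and the record's
`h₆_of_scaling` already suffices; under reading (ii) ∕ ENDₛ (`END-ii-SPEC.md` v1.1 §3(c): `|ωgh·cQ²| = 4N²a²·n⁸`) THIS file's tolerance is the one met, with `k := 4N²a²`.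
Asserts nothing of Bałaban's.  Root-level binders hW ∕ hR-sockets ∕ hSX-socket ∕ D1Tel ∕ D1Rep — 0 discharged; (K) NOT closed; END-ii∕ENDₛ NOT in tree; NOT D1, NOT
`BetaPertH`, NOT continuum, NOT Clay.

ABSOLUTE RULE (cell charter, verbatim): «No internally-minted statement may enter as a cited fact. Every hypothesis is either kernel-proved in this
package or a verbatim quotation of a PUBLISHED theorem with page reference. The manuscript(s) under audit are NOT citable for their own disputed
steps — they are the thing under adjudication; programme-internal (2001/route/tribunal) claims are never citable.»

WHY (an3-g65 SUPPLY S-an3-g65-1 «SUP-VS-MASS CENSUS» §3 h₆: «RE-ROUTING (Mass8-type), tolerance n⁴ ↦ n⁸ = the END-ii letter, met with ZERO room … the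
missing n⁴ is ONE placement per mixed term: keep `F_b(u) := Σ_{z∈B(blk u)}Σ_{t∈B₀}|g_u z|·|Ggh z t|·|g_b t|` OPEN in the pointwise half, bound its BLOCK SUMS
`Σ_{u∈Bβ′}F_b(u) ≤ ((n−1)n⁻⁴)·cNear·G₁′(b)` by M7 at a fixed site then M10 block-column mass then `G₁′(b)`, run the w-sum through `abs_fullSum_weight_le_of_blockDecay_mass`
and the base average through `sum_resSite_jetMass_le`»; ADOPTED VERBATIM by the OWNER d1-p2-g12 WORDS (2) `CLAIMS.log` 2026-08-21T16:15:54Z, FIRST REFUSAL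
gan24-leaf-05 (NT lineage) EXERCISED 16:2xZ).  POWER LEDGER (per `μ ν`, constants n-free): the record reads `|T₆(u,b)| ≤ (cG² + n⁴·cG·S)·E·G₁(u)·G₁′(b)`; here
`|T₆(u,b)| ≤ cG·E·(cG·G₁(u)·G₁′(b) + (n⁴∕2)·(F_b(u) + F′_b(u)))` with block sums `Σ_{u∈Bβ′} G₁(u) ≤ n⁴·((n−1)n⁻⁴)` (M7) and `Σ_{u∈Bβ′}(F_b + F′_b)(u) ≤
2·((n−1)n⁻⁴)·cNear·G₁′(b)` (M7 at a fixed site ∘ M10) ⇒ `m_b = (n−1)·G₁′(b)·(cG + cNear)`; the (1.22) weight costs `n²`, the base average `n⁻⁴Σ_b G₁′(b) ≤ (n−1)n⁻⁴` (M7):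
net `n⁻⁸·cG·n²·(n−1)·(n−1)n⁻⁴ ≤ n⁻⁸·cG` against `(cG + cNear)·(1+4∕δ_u)²K₄(δ_u∕2)` — TOLERANCE n⁸.

CONTENT (all [folklore]; `B = B6QGQLower276.B (n − 1)`, `blk = blk (n − 1)`; block side `n` (`[NeZero n]`), `0 < a`; `g_u = qJetAt ρ n κ u (blk u)`, `g′_b = qJetAt ρ n λ b (blk b)`).
* §1 **`abs_T₆_le_open`** (`|T₆(u,u′)| ≤ cG·e^{−δ_u·dist(blk u, blk u′)}·(cG·G₁(u)·G₁′(u′) + (n⁴∕2)·(F + F′))`, the two contractions displayed).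
* §2 **`sum_B_contraction_le`** (T2's `Σ_{u∈Bβ′}Σ_{z∈B(blk u)}Σ_{t∈B(blk b)}|g_u z|·(|Ggh z t|·|g′_b t|) ≤ ((n−1)n⁻⁴)·(cNear·G₁′(b))`), **`sum_B_contraction'_le`** (T3's mirror).
* §3 `sum_B_compositeMass_le`, `abs_fullSum_T₆_le₈` (one base bond), **`abs_row₆_le₈`** (fixed `n`: `|c·Σ_b n⁻⁴·(n⁻⁸·fullSum …)| ≤ |c|·(n⁸)⁻¹·(cG·(cG + cNear)·((1+4∕δ_u)²·K₄(δ_u∕2)))`).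
* §4 **`h₆_of_scaling₈ (ha) (hk : ∀ n ≥ 2, |ωgh n * (cQ n * cQ n)| ≤ k * n^8) (μ ν) ⊢ h₆` VERBATIM** (the record's `h₆_of_scaling` conclusion shape), `C₆ := k·(cG 4 a·(cG 4 a + cNear a)·((1 + 4∕deltaU 4 a)²·latticeConst 4 (deltaU 4 a∕2)))`.
Unit `b2b-balaban-gan24-formalise-leaf-05` (gen 44), G-an2-4 swarm leaf seat on road «BF-x» (NT lineage); `LEAVES-BFx.md` row (N-2) «T₆-ii» PART 2.
-/

noncomputable section

namespace Summit.QuantumFields.BalabanUV.Beta.D1BFx.NeedleGhostBubble2RowMass8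

open Finset
open scoped BigOperators
open Literature.MathematicalPhysics.QuantumFieldTheory.Balaban1983to89
open Literature.MathematicalPhysics.QuantumFieldTheory.Balaban1983to89.Beta
open B4Sect5Proof (latticeConst latticeConst_nonneg)
open B6QGQLower276 (X blk B mem_B)
open B6QGQDecay237 (deltaU deltaU_pos)
open ExpKernelCalculus (Site MKer)
open DyadicShell (Pt toReal)
open WindowIdentification (fullSum)
open DressedMomentNormalisation (resSite)
open Summit.QuantumFields.BalabanUV.Beta.D1BFx.PackedKernelSplit (biBubble)
open Summit.QuantumFields.BalabanUV.Beta.D1BFx.FineHessianSectors (biBubbleTable biBubbleTable_apply)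
open Summit.QuantumFields.BalabanUV.Beta.D1BFx.GhostStencilRooted (qJetAt qAntiAt)
open Summit.QuantumFields.BalabanUV.Beta.D1BFx.GhostStencilRootedReflection (ctrHalf ctrHalf_mem)
open Summit.QuantumFields.BalabanUV.Beta.D1BFx.GhostLeg (Ggh Ggh_symm const_nonneg)
open Summit.QuantumFields.BalabanUV.Beta.D1BFx.GhostLegFree (ghDelta ghDelta_pos)
open Summit.QuantumFields.BalabanUV.Beta.D1BFx.GhostLegBlockMass (cNear ghA0_pos sum_B_abs_Ggh_le)
open Summit.QuantumFields.BalabanUV.Beta.D1BFx.BlockColumnSupNorm (cG cG_pos abs_gq_le_sup)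
open Summit.QuantumFields.BalabanUV.Beta.D1BFx.NeedleBondMarginal (sum_bond_abs_qJetAt_le_of_root)
open Summit.QuantumFields.BalabanUV.Beta.D1BFx.NeedleGhostBubble2Row (abs_fullSum_weight_le_of_blockDecay_mass sum_B_Ggh_eq_gq sum_B_Ggh_col_eq_gq
  sum_B_jetMass_le sum_resSite_jetMass_le)
open Summit.QuantumFields.BalabanUV.Beta.D1BFx.NeedleGhostBubble2PointwiseOpen (abs_biBubble_qAntiAt_qAntiAt_le_open)

variable (n : ℕ) [NeZero n] (a : ℝ)

/-- [folklore] The block-mass constant of M10 is nonnegative. -/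
theorem cNear_nonneg {a : ℝ} (ha : 0 < a) : 0 ≤ cNear a := by
  unfold cNear
  have h1 := const_nonneg a ha
  have h2 := ghA0_pos ha
  positivity

/-! ## §1 The pointwise bound at the ghost leg with the mixed contractions open -/

/-- [folklore] **THE POINTWISE BOUND OF `T₆ = qA ⊗ qA` OVER THE GHOST LEG, MIXED CONTRACTIONS OPEN**: with `E = e^{−δ_u·dist(blk u, blk u′)}`,
`|T₆(u, u′)| ≤ cG·E·(cG·G₁(u)·G₁′(u′) + (n⁴∕2)·(Σ_{z∈B(blk u)}Σ_{t∈B(blk u′)}|g_u z|·(|Ggh z t|·|g′ t|) + Σ_{x∈B(blk u′)}Σ_{t∈B(blk u)}|g′ x|·(|Ggh x t|·|g_u t|)))`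
(legs by the signed block sums `gq ≤ cG·E` — rows and columns, `Ggh_symm`; NO sup). -/
theorem abs_T₆_le_open (ha : 0 < a) (ρ : Site 4) (κ lam : Fin 4) (u u' : Site 4) :
    |biBubbleTable (Ggh n a) (Ggh n a) (qAntiAt ρ n) (qAntiAt ρ n) κ lam u u'| ≤
      cG 4 a * Real.exp (-(deltaU 4 a * dist (blk (n - 1) u) (blk (n - 1) u'))) *
        (cG 4 a * ((∑ z ∈ B (n - 1) (blk (n - 1) u), |qJetAt ρ n κ u (blk (n - 1) u) z|) *
            (∑ x ∈ B (n - 1) (blk (n - 1) u'), |qJetAt ρ n lam u' (blk (n - 1) u') x|))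
          + (n : ℝ) ^ 4 / 2 *
            ((∑ z ∈ B (n - 1) (blk (n - 1) u), ∑ t ∈ B (n - 1) (blk (n - 1) u'),
                |qJetAt ρ n κ u (blk (n - 1) u) z| * (|Ggh n a z t () ()| * |qJetAt ρ n lam u' (blk (n - 1) u') t|))
             + (∑ x ∈ B (n - 1) (blk (n - 1) u'), ∑ t ∈ B (n - 1) (blk (n - 1) u),
                |qJetAt ρ n lam u' (blk (n - 1) u') x| * (|Ggh n a x t () ()| * |qJetAt ρ n κ u (blk (n - 1) u) t|)))) := by
  have hn : (0 : ℝ) < n := Nat.cast_pos.mpr (Nat.pos_of_ne_zero (NeZero.ne n))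
  have hcG := (cG_pos 4 ha).le
  set Y := blk (n - 1) u with hY
  set Y' := blk (n - 1) u' with hY'
  set E : ℝ := Real.exp (-(deltaU 4 a * dist Y Y')) with hE
  have hE0 : 0 ≤ E := (Real.exp_pos _).le
  have hE1 : E ≤ 1 := Real.exp_le_one_iff.2 (by have := deltaU_pos 4 ha; nlinarith [dist_nonneg (x := Y) (y := Y')])
  -- the leg letters (signed block sums only)
  have hRA : ∀ x ∈ B (n - 1) Y', |∑ t ∈ B (n - 1) Y, Ggh n a x t () ()| ≤ cG 4 a * E := by
    intro x hx
    rw [sum_B_Ggh_eq_gq]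
    have h := abs_gq_le_sup (d := 4) (by norm_num) (n - 1) ha x Y
    rwa [mem_B.1 hx, dist_comm] at h
  have hRK : ∀ z ∈ B (n - 1) Y, |∑ t ∈ B (n - 1) Y', Ggh n a z t () ()| ≤ cG 4 a * E := by
    intro z hz
    rw [sum_B_Ggh_eq_gq]
    have h := abs_gq_le_sup (d := 4) (by norm_num) (n - 1) ha z Y'
    rwa [mem_B.1 hz] at h
  have hCA : ∀ t ∈ B (n - 1) Y, |∑ x ∈ B (n - 1) Y', Ggh n a x t () ()| ≤ cG 4 a * E := by
    intro t ht
    rw [sum_B_Ggh_col_eq_gq n a ha]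
    have h := abs_gq_le_sup (d := 4) (by norm_num) (n - 1) ha t Y'
    rwa [mem_B.1 ht] at h
  have hCK : ∀ t ∈ B (n - 1) Y', |∑ z ∈ B (n - 1) Y, Ggh n a z t () ()| ≤ cG 4 a * E := by
    intro t ht
    rw [sum_B_Ggh_col_eq_gq n a ha]
    have h := abs_gq_le_sup (d := 4) (by norm_num) (n - 1) ha t Y
    rwa [mem_B.1 ht, dist_comm] at h
  have h := abs_biBubble_qAntiAt_qAntiAt_le_open ρ n κ u lam u' (Ggh n a) (Ggh n a) (by positivity) hRA hRK hCA hCK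
  set G₁ := ∑ z ∈ B (n - 1) Y, |qJetAt ρ n κ u Y z| with hG₁
  set G₁' := ∑ x ∈ B (n - 1) Y', |qJetAt ρ n lam u' Y' x| with hG₁'
  set F₂ := ∑ z ∈ B (n - 1) Y, ∑ t ∈ B (n - 1) Y', |qJetAt ρ n κ u Y z| * (|Ggh n a z t () ()| * |qJetAt ρ n lam u' Y' t|) with hF₂
  set F₃ := ∑ x ∈ B (n - 1) Y', ∑ t ∈ B (n - 1) Y, |qJetAt ρ n lam u' Y' x| * (|Ggh n a x t () ()| * |qJetAt ρ n κ u Y t|) with hF₃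
  have hG0 : 0 ≤ G₁ * G₁' := mul_nonneg (Finset.sum_nonneg fun _ _ => abs_nonneg _) (Finset.sum_nonneg fun _ _ => abs_nonneg _)
  have hF₂0 : 0 ≤ F₂ := Finset.sum_nonneg fun _ _ => Finset.sum_nonneg fun _ _ => by positivity
  have hF₃0 : 0 ≤ F₃ := Finset.sum_nonneg fun _ _ => Finset.sum_nonneg fun _ _ => by positivity
  rw [biBubbleTable_apply, abs_mul, show |(-(1 / 2 : ℝ))| = 1 / 2 by norm_num]
  have hcoef : (cG 4 a * E * (cG 4 a * E) + cG 4 a * E * (cG 4 a * E)) * (G₁ * G₁') ≤ 2 * (cG 4 a * E * (cG 4 a * (G₁ * G₁'))) := by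
    have h1 : E * E ≤ E := by nlinarith
    nlinarith [mul_nonneg (mul_nonneg (mul_nonneg hcG hcG) (sub_nonneg.2 h1)) hG0]
  calc 1 / 2 * |biBubble (Ggh n a) (qAntiAt ρ n κ u) (Ggh n a) (qAntiAt ρ n lam u')|
      ≤ 1 / 2 * ((cG 4 a * E * (cG 4 a * E) + cG 4 a * E * (cG 4 a * E)) * (G₁ * G₁') + (n : ℝ) ^ 4 * (cG 4 a * E) * F₂
          + (n : ℝ) ^ 4 * (cG 4 a * E) * F₃) := mul_le_mul_of_nonneg_left h (by norm_num)
    _ ≤ 1 / 2 * (2 * (cG 4 a * E * (cG 4 a * (G₁ * G₁'))) + (n : ℝ) ^ 4 * (cG 4 a * E) * F₂ + (n : ℝ) ^ 4 * (cG 4 a * E) * F₃) := by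
        gcongr
    _ = cG 4 a * E * (cG 4 a * (G₁ * G₁') + (n : ℝ) ^ 4 / 2 * (F₂ + F₃)) := by ring

/-! ## §2 The block sums of the two open contractions: M7 at a fixed leg site, then M10 -/

/-- [folklore] **T2's CONTRACTION SUMMED OVER A BLOCK OF RUNNING BONDS** (in-block root `ρ`): for every block `β′` and base bond `b`,
`Σ_{u∈B β′} Σ_{z∈B(blk u)} Σ_{t∈B(blk b)} |g_u z|·(|Ggh z t|·|g′_b t|) ≤ ((n−1)·n⁻⁴)·(cNear a·G₁′(b))` — the running bond summed FIRST at the fixed leg site `z` (M7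
`sum_bond_abs_qJetAt_le_of_root`), then the leg's block-COLUMN |·|-mass at `t` (M10 `sum_B_abs_Ggh_le` ∘ `Ggh_symm`, decay ≤ 1), then the base jet's ℓ¹-mass. -/
theorem sum_B_contraction_le (ha : 0 < a) {ρ : Site 4} (hρ : ∀ i : Fin 4, 0 ≤ ρ i ∧ ρ i < n) (κ lam : Fin 4) (b β' : Site 4) :
    ∑ u ∈ B (n - 1) β', ∑ z ∈ B (n - 1) (blk (n - 1) u), ∑ t ∈ B (n - 1) (blk (n - 1) b),
        |qJetAt ρ n κ u (blk (n - 1) u) z| * (|Ggh n a z t () ()| * |qJetAt ρ n lam b (blk (n - 1) b) t|)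
      ≤ (((n : ℝ) - 1) * ((n : ℝ) ^ 4)⁻¹) * (cNear a * ∑ t ∈ B (n - 1) (blk (n - 1) b), |qJetAt ρ n lam b (blk (n - 1) b) t|) := by
  have hcN := cNear_nonneg ha
  -- in-block: `blk u = β′`
  have e : ∑ u ∈ B (n - 1) β', ∑ z ∈ B (n - 1) (blk (n - 1) u), ∑ t ∈ B (n - 1) (blk (n - 1) b),
        |qJetAt ρ n κ u (blk (n - 1) u) z| * (|Ggh n a z t () ()| * |qJetAt ρ n lam b (blk (n - 1) b) t|)
      = ∑ u ∈ B (n - 1) β', ∑ z ∈ B (n - 1) β', ∑ t ∈ B (n - 1) (blk (n - 1) b),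
        |qJetAt ρ n κ u β' z| * (|Ggh n a z t () ()| * |qJetAt ρ n lam b (blk (n - 1) b) t|) :=
    Finset.sum_congr rfl fun u hu => by rw [mem_B.1 hu]
  rw [e, Finset.sum_comm]
  -- at a fixed leg site `z`: the running bond first
  have hz : ∀ z ∈ B (n - 1) β', ∑ u ∈ B (n - 1) β', ∑ t ∈ B (n - 1) (blk (n - 1) b),
      |qJetAt ρ n κ u β' z| * (|Ggh n a z t () ()| * |qJetAt ρ n lam b (blk (n - 1) b) t|)
        ≤ (((n : ℝ) - 1) * ((n : ℝ) ^ 4)⁻¹) * ∑ t ∈ B (n - 1) (blk (n - 1) b), |Ggh n a z t () ()| * |qJetAt ρ n lam b (blk (n - 1) b) t| := by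
    intro z _
    rw [Finset.sum_comm]
    have e1 : ∀ t ∈ B (n - 1) (blk (n - 1) b), ∑ u ∈ B (n - 1) β', |qJetAt ρ n κ u β' z| * (|Ggh n a z t () ()| * |qJetAt ρ n lam b (blk (n - 1) b) t|)
        = (∑ u ∈ B (n - 1) β', |qJetAt ρ n κ u β' z|) * (|Ggh n a z t () ()| * |qJetAt ρ n lam b (blk (n - 1) b) t|) := fun t _ => by
      rw [Finset.sum_mul]
    rw [Finset.sum_congr rfl e1, Finset.mul_sum]
    exact Finset.sum_le_sum fun t _ => mul_le_mul_of_nonneg_right (sum_bond_abs_qJetAt_le_of_root n κ hρ (B (n - 1) β') β' z) (by positivity)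
  refine (Finset.sum_le_sum hz).trans ?_
  rw [← Finset.mul_sum, Finset.sum_comm]
  refine mul_le_mul_of_nonneg_left ?_ (mul_nonneg (by linarith [show (1 : ℝ) ≤ n by exact_mod_cast NeZero.one_le]) (by positivity))
  -- the leg's block-column mass at `t`
  have ht : ∀ t ∈ B (n - 1) (blk (n - 1) b), ∑ z ∈ B (n - 1) β', |Ggh n a z t () ()| * |qJetAt ρ n lam b (blk (n - 1) b) t|
      ≤ cNear a * |qJetAt ρ n lam b (blk (n - 1) b) t| := by
    intro t _
    rw [← Finset.sum_mul]
    refine mul_le_mul_of_nonneg_right ?_ (abs_nonneg _)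
    have hcol : ∑ z ∈ B (n - 1) β', |Ggh n a z t () ()| = ∑ z ∈ B (n - 1) β', |Ggh n a t z () ()| :=
      Finset.sum_congr rfl fun z _ => by rw [Ggh_symm n a ha z t () ()]
    rw [hcol]
    refine (sum_B_abs_Ggh_le n ha t β').trans ?_
    have hE1 : Real.exp (-(ghDelta a * dist (blk (n - 1) t) β')) ≤ 1 :=
      Real.exp_le_one_iff.2 (by have := ghDelta_pos ha; nlinarith [dist_nonneg (x := blk (n - 1) t) (y := β')])
    exact (mul_le_mul_of_nonneg_left hE1 hcN).trans (le_of_eq (mul_one _))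
  refine (Finset.sum_le_sum ht).trans (le_of_eq ?_)
  rw [Finset.mul_sum]

/-- [folklore] **T3's CONTRACTION SUMMED OVER A BLOCK OF RUNNING BONDS**: `Σ_{u∈B β′} Σ_{x∈B(blk b)} Σ_{t∈B(blk u)} |g′_b x|·(|Ggh x t|·|g_u t|) ≤ ((n−1)·n⁻⁴)·(cNear a·G₁′(b))`
— the running bond summed first at the fixed leg site `t` (M7), then the leg's block-ROW |·|-mass at `x` over `β′` (M10, decay ≤ 1), then `G₁′(b)`. -/
theorem sum_B_contraction'_le (ha : 0 < a) {ρ : Site 4} (hρ : ∀ i : Fin 4, 0 ≤ ρ i ∧ ρ i < n) (κ lam : Fin 4) (b β' : Site 4) :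
    ∑ u ∈ B (n - 1) β', ∑ x ∈ B (n - 1) (blk (n - 1) b), ∑ t ∈ B (n - 1) (blk (n - 1) u),
        |qJetAt ρ n lam b (blk (n - 1) b) x| * (|Ggh n a x t () ()| * |qJetAt ρ n κ u (blk (n - 1) u) t|)
      ≤ (((n : ℝ) - 1) * ((n : ℝ) ^ 4)⁻¹) * (cNear a * ∑ x ∈ B (n - 1) (blk (n - 1) b), |qJetAt ρ n lam b (blk (n - 1) b) x|) := by
  have hcN := cNear_nonneg ha
  have hQ : 0 ≤ ((n : ℝ) - 1) * ((n : ℝ) ^ 4)⁻¹ := mul_nonneg (by linarith [show (1 : ℝ) ≤ n by exact_mod_cast NeZero.one_le]) (by positivity)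
  have e : ∑ u ∈ B (n - 1) β', ∑ x ∈ B (n - 1) (blk (n - 1) b), ∑ t ∈ B (n - 1) (blk (n - 1) u),
        |qJetAt ρ n lam b (blk (n - 1) b) x| * (|Ggh n a x t () ()| * |qJetAt ρ n κ u (blk (n - 1) u) t|)
      = ∑ u ∈ B (n - 1) β', ∑ x ∈ B (n - 1) (blk (n - 1) b), ∑ t ∈ B (n - 1) β',
        |qJetAt ρ n lam b (blk (n - 1) b) x| * (|Ggh n a x t () ()| * |qJetAt ρ n κ u β' t|) :=
    Finset.sum_congr rfl fun u hu => by rw [mem_B.1 hu]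
  rw [e, Finset.sum_comm, Finset.mul_sum, Finset.mul_sum]
  refine Finset.sum_le_sum fun x _ => ?_
  -- fixed base needle site `x`: swap `u` and `t`, sum the running bond at the fixed leg site `t`
  rw [Finset.sum_comm]
  have ht : ∀ t ∈ B (n - 1) β', ∑ u ∈ B (n - 1) β', |qJetAt ρ n lam b (blk (n - 1) b) x| * (|Ggh n a x t () ()| * |qJetAt ρ n κ u β' t|)
      ≤ |qJetAt ρ n lam b (blk (n - 1) b) x| * (|Ggh n a x t () ()| * (((n : ℝ) - 1) * ((n : ℝ) ^ 4)⁻¹)) := by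
    intro t _
    have e1 : ∑ u ∈ B (n - 1) β', |qJetAt ρ n lam b (blk (n - 1) b) x| * (|Ggh n a x t () ()| * |qJetAt ρ n κ u β' t|)
        = |qJetAt ρ n lam b (blk (n - 1) b) x| * (|Ggh n a x t () ()| * ∑ u ∈ B (n - 1) β', |qJetAt ρ n κ u β' t|) := by
      rw [Finset.mul_sum, Finset.mul_sum]
    rw [e1]
    exact mul_le_mul_of_nonneg_left (mul_le_mul_of_nonneg_left (sum_bond_abs_qJetAt_le_of_root n κ hρ (B (n - 1) β') β' t) (abs_nonneg _)) (abs_nonneg _)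
  refine (Finset.sum_le_sum ht).trans ?_
  rw [← Finset.mul_sum, ← Finset.sum_mul]
  calc |qJetAt ρ n lam b (blk (n - 1) b) x| * ((∑ t ∈ B (n - 1) β', |Ggh n a x t () ()|) * (((n : ℝ) - 1) * ((n : ℝ) ^ 4)⁻¹))
      ≤ |qJetAt ρ n lam b (blk (n - 1) b) x| * (cNear a * (((n : ℝ) - 1) * ((n : ℝ) ^ 4)⁻¹)) := by
        refine mul_le_mul_of_nonneg_left (mul_le_mul_of_nonneg_right ?_ hQ) (abs_nonneg _)
        refine (sum_B_abs_Ggh_le n ha x β').trans ?_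
        have hE1 : Real.exp (-(ghDelta a * dist (blk (n - 1) x) β')) ≤ 1 :=
          Real.exp_le_one_iff.2 (by have := ghDelta_pos ha; nlinarith [dist_nonneg (x := blk (n - 1) x) (y := β')])
        exact (mul_le_mul_of_nonneg_left hE1 hcN).trans (le_of_eq (mul_one _))
    _ = ((n : ℝ) - 1) * ((n : ℝ) ^ 4)⁻¹ * (cNear a * |qJetAt ρ n lam b (blk (n - 1) b) x|) := by ring

/-! ## §3 The row of `T₆` at fixed `n` — tolerance `n⁸` -/

/-- [folklore] **THE COMPOSITE MASS HAS BOUNDED BLOCK SUMS**: for every block `β′` and base bond `b` (needles rooted at `ctrHalf n`),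
`Σ_{u∈Bβ′} [cG·G₁(u)·G₁′(b) + (n⁴∕2)·(F_b(u) + F′_b(u))] ≤ (n⁴·((n−1)n⁻⁴))·(G₁′(b)·(cG + cNear))` (M7 per block for `G₁`; §2 for the contractions). -/
theorem sum_B_compositeMass_le (ha : 0 < a) (μ ν : Fin 4) (b β' : Site 4) :
    ∑ u ∈ B (n - 1) β', (cG 4 a * ((∑ z ∈ B (n - 1) (blk (n - 1) u), |qJetAt (ctrHalf n) n μ u (blk (n - 1) u) z|) *
          ∑ x ∈ B (n - 1) (blk (n - 1) b), |qJetAt (ctrHalf n) n ν b (blk (n - 1) b) x|)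
        + (n : ℝ) ^ 4 / 2 *
          ((∑ z ∈ B (n - 1) (blk (n - 1) u), ∑ t ∈ B (n - 1) (blk (n - 1) b),
              |qJetAt (ctrHalf n) n μ u (blk (n - 1) u) z| * (|Ggh n a z t () ()| * |qJetAt (ctrHalf n) n ν b (blk (n - 1) b) t|))
           + (∑ x ∈ B (n - 1) (blk (n - 1) b), ∑ t ∈ B (n - 1) (blk (n - 1) u),
              |qJetAt (ctrHalf n) n ν b (blk (n - 1) b) x| * (|Ggh n a x t () ()| * |qJetAt (ctrHalf n) n μ u (blk (n - 1) u) t|))))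
      ≤ ((n : ℝ) ^ 4 * (((n : ℝ) - 1) * ((n : ℝ) ^ 4)⁻¹)) *
          ((∑ x ∈ B (n - 1) (blk (n - 1) b), |qJetAt (ctrHalf n) n ν b (blk (n - 1) b) x|) * (cG 4 a + cNear a)) := by
  have hcG := (cG_pos 4 ha).le
  have hb : 0 ≤ ∑ x ∈ B (n - 1) (blk (n - 1) b), |qJetAt (ctrHalf n) n ν b (blk (n - 1) b) x| := Finset.sum_nonneg fun _ _ => abs_nonneg _
  have hn4 : (0 : ℝ) ≤ (n : ℝ) ^ 4 / 2 := by positivity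
  rw [Finset.sum_add_distrib, ← Finset.mul_sum, ← Finset.sum_mul, ← Finset.mul_sum, Finset.sum_add_distrib]
  have h1 := sum_B_jetMass_le n (ctrHalf_mem n) μ β'
  have h2 := sum_B_contraction_le n a ha (ctrHalf_mem n) μ ν b β'
  have h3 := sum_B_contraction'_le n a ha (ctrHalf_mem n) μ ν b β'
  refine (add_le_add (mul_le_mul_of_nonneg_left (mul_le_mul_of_nonneg_right h1 hb) hcG) (mul_le_mul_of_nonneg_left (add_le_add h2 h3) hn4)).trans ?_
  exact le_of_eq (by ring)

/-- [folklore] **THE `w`-SUM OF `T₆` AT ONE BASE BOND, TOLERANCE FORM**: `|fullSum (w ↦ w_μw_ν·T₆(b+w, b))| ≤ cG·(n²·((1+4∕δ_u)²·((n⁴·((n−1)n⁻⁴))·(G₁′(b)·(cG + cNear))·K₄(δ_u∕2))))`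
(«NT-6» §1 `abs_fullSum_weight_le_of_blockDecay_mass` with the composite mass). -/
theorem abs_fullSum_T₆_le₈ (ha : 0 < a) (μ ν : Fin 4) (b : Pt) :
    |fullSum (fun w : Pt => toReal w μ * toReal w ν *
        biBubbleTable (Ggh n a) (Ggh n a) (qAntiAt (ctrHalf n) n) (qAntiAt (ctrHalf n) n) μ ν (b + w) b)|
      ≤ cG 4 a * ((n : ℝ) ^ 2 * ((1 + 4 / deltaU 4 a) ^ 2 *
          ((((n : ℝ) ^ 4 * (((n : ℝ) - 1) * ((n : ℝ) ^ 4)⁻¹)) *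
            ((∑ x ∈ B (n - 1) (blk (n - 1) b), |qJetAt (ctrHalf n) n ν b (blk (n - 1) b) x|) * (cG 4 a + cNear a))) *
              latticeConst 4 (deltaU 4 a / 2)))) := by
  have hcG := (cG_pos 4 ha).le
  have hδ := deltaU_pos 4 ha
  have hb : 0 ≤ ∑ x ∈ B (n - 1) (blk (n - 1) b), |qJetAt (ctrHalf n) n ν b (blk (n - 1) b) x| := Finset.sum_nonneg fun _ _ => abs_nonneg _
  have hF0 : ∀ u : Site 4, 0 ≤ cG 4 a * ((∑ z ∈ B (n - 1) (blk (n - 1) u), |qJetAt (ctrHalf n) n μ u (blk (n - 1) u) z|) *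
          ∑ x ∈ B (n - 1) (blk (n - 1) b), |qJetAt (ctrHalf n) n ν b (blk (n - 1) b) x|)
        + (n : ℝ) ^ 4 / 2 *
          ((∑ z ∈ B (n - 1) (blk (n - 1) u), ∑ t ∈ B (n - 1) (blk (n - 1) b),
              |qJetAt (ctrHalf n) n μ u (blk (n - 1) u) z| * (|Ggh n a z t () ()| * |qJetAt (ctrHalf n) n ν b (blk (n - 1) b) t|))
           + (∑ x ∈ B (n - 1) (blk (n - 1) b), ∑ t ∈ B (n - 1) (blk (n - 1) u),
              |qJetAt (ctrHalf n) n ν b (blk (n - 1) b) x| * (|Ggh n a x t () ()| * |qJetAt (ctrHalf n) n μ u (blk (n - 1) u) t|))) := by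
    intro u
    have h1 : 0 ≤ ∑ z ∈ B (n - 1) (blk (n - 1) u), |qJetAt (ctrHalf n) n μ u (blk (n - 1) u) z| := Finset.sum_nonneg fun _ _ => abs_nonneg _
    have h2 : 0 ≤ ∑ z ∈ B (n - 1) (blk (n - 1) u), ∑ t ∈ B (n - 1) (blk (n - 1) b),
        |qJetAt (ctrHalf n) n μ u (blk (n - 1) u) z| * (|Ggh n a z t () ()| * |qJetAt (ctrHalf n) n ν b (blk (n - 1) b) t|) :=
      Finset.sum_nonneg fun _ _ => Finset.sum_nonneg fun _ _ => by positivity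
    have h3 : 0 ≤ ∑ x ∈ B (n - 1) (blk (n - 1) b), ∑ t ∈ B (n - 1) (blk (n - 1) u),
        |qJetAt (ctrHalf n) n ν b (blk (n - 1) b) x| * (|Ggh n a x t () ()| * |qJetAt (ctrHalf n) n μ u (blk (n - 1) u) t|) :=
      Finset.sum_nonneg fun _ _ => Finset.sum_nonneg fun _ _ => by positivity
    positivity
  exact abs_fullSum_weight_le_of_blockDecay_mass n (f := fun w : Pt =>
      biBubbleTable (Ggh n a) (Ggh n a) (qAntiAt (ctrHalf n) n) (qAntiAt (ctrHalf n) n) μ ν (b + w) b)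
    (F := fun u : Site 4 => cG 4 a * ((∑ z ∈ B (n - 1) (blk (n - 1) u), |qJetAt (ctrHalf n) n μ u (blk (n - 1) u) z|) *
          ∑ x ∈ B (n - 1) (blk (n - 1) b), |qJetAt (ctrHalf n) n ν b (blk (n - 1) b) x|)
        + (n : ℝ) ^ 4 / 2 *
          ((∑ z ∈ B (n - 1) (blk (n - 1) u), ∑ t ∈ B (n - 1) (blk (n - 1) b),
              |qJetAt (ctrHalf n) n μ u (blk (n - 1) u) z| * (|Ggh n a z t () ()| * |qJetAt (ctrHalf n) n ν b (blk (n - 1) b) t|))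
           + (∑ x ∈ B (n - 1) (blk (n - 1) b), ∑ t ∈ B (n - 1) (blk (n - 1) u),
              |qJetAt (ctrHalf n) n ν b (blk (n - 1) b) x| * (|Ggh n a x t () ()| * |qJetAt (ctrHalf n) n μ u (blk (n - 1) u) t|))))
    hcG hδ hF0 (sum_B_compositeMass_le n a ha μ ν b) b μ ν (fun w => abs_T₆_le_open n a ha (ctrHalf n) μ ν (b + w) b)

/-- [folklore] **THE ROW OF `T₆` AT FIXED `n`, TOLERANCE n⁸**, for any scalar prefactor `c`:
`|c·Σ_{b ∈ image resSite} n⁻⁴·(n⁻⁸·fullSum (w ↦ w_μw_ν·T₆(b+w,b)))| ≤ |c|·(n⁸)⁻¹·(cG 4 a·(cG 4 a + cNear a)·((1 + 4∕δ_u)²·latticeConst 4 (δ_u∕2)))`. -/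
theorem abs_row₆_le₈ (ha : 0 < a) (c : ℝ) (μ ν : Fin 4) :
    |c * ∑ b ∈ (univ : Finset (Fin 4 → Fin n)).image resSite, ((n : ℝ) ^ 4)⁻¹ * (((n : ℝ) ^ 8)⁻¹ *
        fullSum (fun w : Pt => toReal w μ * toReal w ν *
          biBubbleTable (Ggh n a) (Ggh n a) (qAntiAt (ctrHalf n) n) (qAntiAt (ctrHalf n) n) μ ν (b + w) b))|
      ≤ |c| * (((n : ℝ) ^ 8)⁻¹ * (cG 4 a * (cG 4 a + cNear a) * ((1 + 4 / deltaU 4 a) ^ 2 * latticeConst 4 (deltaU 4 a / 2)))) := by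
  have hn : (0 : ℝ) < n := Nat.cast_pos.mpr (Nat.pos_of_ne_zero (NeZero.ne n))
  have hn1 : (1 : ℝ) ≤ n := by exact_mod_cast NeZero.one_le
  have hcG := (cG_pos 4 ha).le
  have hcN := cNear_nonneg ha
  have hδ := deltaU_pos 4 ha
  have hL := latticeConst_nonneg 4 (half_pos hδ).le
  have hQ0 : 0 ≤ ((n : ℝ) - 1) * ((n : ℝ) ^ 4)⁻¹ := mul_nonneg (by linarith) (by positivity)
  have hP0 : 0 ≤ (n : ℝ) ^ 4 * (((n : ℝ) - 1) * ((n : ℝ) ^ 4)⁻¹) := mul_nonneg (by positivity) hQ0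
  -- the n-free prefactor of one base bond's word, per unit of base jet mass
  have hR0 : 0 ≤ ((n : ℝ) ^ 8)⁻¹ * (cG 4 a * ((n : ℝ) ^ 2 * ((1 + 4 / deltaU 4 a) ^ 2 *
      ((((n : ℝ) ^ 4 * (((n : ℝ) - 1) * ((n : ℝ) ^ 4)⁻¹)) * (cG 4 a + cNear a)) * latticeConst 4 (deltaU 4 a / 2))))) := by positivity
  -- the base sites
  have hsum : |∑ b ∈ (univ : Finset (Fin 4 → Fin n)).image resSite, ((n : ℝ) ^ 4)⁻¹ * (((n : ℝ) ^ 8)⁻¹ *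
        fullSum (fun w : Pt => toReal w μ * toReal w ν *
          biBubbleTable (Ggh n a) (Ggh n a) (qAntiAt (ctrHalf n) n) (qAntiAt (ctrHalf n) n) μ ν (b + w) b))|
      ≤ ((n : ℝ) ^ 8)⁻¹ * (cG 4 a * ((n : ℝ) ^ 2 * ((1 + 4 / deltaU 4 a) ^ 2 *
          ((((n : ℝ) ^ 4 * (((n : ℝ) - 1) * ((n : ℝ) ^ 4)⁻¹)) * (cG 4 a + cNear a)) * latticeConst 4 (deltaU 4 a / 2))))) *
            (((n : ℝ) - 1) * ((n : ℝ) ^ 4)⁻¹) := by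
    refine (Finset.abs_sum_le_sum_abs _ _).trans ?_
    calc ∑ b ∈ (univ : Finset (Fin 4 → Fin n)).image resSite, |((n : ℝ) ^ 4)⁻¹ * (((n : ℝ) ^ 8)⁻¹ *
          fullSum (fun w : Pt => toReal w μ * toReal w ν *
            biBubbleTable (Ggh n a) (Ggh n a) (qAntiAt (ctrHalf n) n) (qAntiAt (ctrHalf n) n) μ ν (b + w) b))|
        ≤ ∑ b ∈ (univ : Finset (Fin 4 → Fin n)).image resSite, ((n : ℝ) ^ 8)⁻¹ * (cG 4 a * ((n : ℝ) ^ 2 * ((1 + 4 / deltaU 4 a) ^ 2 *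
            ((((n : ℝ) ^ 4 * (((n : ℝ) - 1) * ((n : ℝ) ^ 4)⁻¹)) * (cG 4 a + cNear a)) * latticeConst 4 (deltaU 4 a / 2))))) *
              (((n : ℝ) ^ 4)⁻¹ * ∑ x ∈ B (n - 1) (blk (n - 1) b), |qJetAt (ctrHalf n) n ν b (blk (n - 1) b) x|) := by
          refine Finset.sum_le_sum fun b _ => ?_
          rw [abs_mul, abs_mul, abs_of_nonneg (by positivity : (0 : ℝ) ≤ ((n : ℝ) ^ 4)⁻¹),
            abs_of_nonneg (by positivity : (0 : ℝ) ≤ ((n : ℝ) ^ 8)⁻¹)]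
          have hw := abs_fullSum_T₆_le₈ n a ha μ ν b
          calc ((n : ℝ) ^ 4)⁻¹ * (((n : ℝ) ^ 8)⁻¹ * |fullSum (fun w : Pt => toReal w μ * toReal w ν *
                biBubbleTable (Ggh n a) (Ggh n a) (qAntiAt (ctrHalf n) n) (qAntiAt (ctrHalf n) n) μ ν (b + w) b)|)
              ≤ ((n : ℝ) ^ 4)⁻¹ * (((n : ℝ) ^ 8)⁻¹ * (cG 4 a * ((n : ℝ) ^ 2 * ((1 + 4 / deltaU 4 a) ^ 2 *
                  ((((n : ℝ) ^ 4 * (((n : ℝ) - 1) * ((n : ℝ) ^ 4)⁻¹)) *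
                    ((∑ x ∈ B (n - 1) (blk (n - 1) b), |qJetAt (ctrHalf n) n ν b (blk (n - 1) b) x|) * (cG 4 a + cNear a))) *
                      latticeConst 4 (deltaU 4 a / 2)))))) :=
                mul_le_mul_of_nonneg_left (mul_le_mul_of_nonneg_left hw (by positivity)) (by positivity)
            _ = _ := by ring
      _ = ((n : ℝ) ^ 8)⁻¹ * (cG 4 a * ((n : ℝ) ^ 2 * ((1 + 4 / deltaU 4 a) ^ 2 *
            ((((n : ℝ) ^ 4 * (((n : ℝ) - 1) * ((n : ℝ) ^ 4)⁻¹)) * (cG 4 a + cNear a)) * latticeConst 4 (deltaU 4 a / 2))))) *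
            ∑ b ∈ (univ : Finset (Fin 4 → Fin n)).image resSite,
              ((n : ℝ) ^ 4)⁻¹ * ∑ x ∈ B (n - 1) (blk (n - 1) b), |qJetAt (ctrHalf n) n ν b (blk (n - 1) b) x| := by rw [Finset.mul_sum]
      _ ≤ _ := mul_le_mul_of_nonneg_left (sum_resSite_jetMass_le n ν) hR0
  rw [abs_mul]
  refine (mul_le_mul_of_nonneg_left hsum (abs_nonneg c)).trans (mul_le_mul_of_nonneg_left ?_ (abs_nonneg c))
  -- the n-power ledger: n² · (n⁴·(n−1)n⁻⁴) · ((n−1)n⁻⁴) = ((n−1)∕n)² ≤ 1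
  have hPQ : (n : ℝ) ^ 2 * ((n : ℝ) ^ 4 * (((n : ℝ) - 1) * ((n : ℝ) ^ 4)⁻¹)) * (((n : ℝ) - 1) * ((n : ℝ) ^ 4)⁻¹) ≤ 1 := by
    have e : (n : ℝ) ^ 2 * ((n : ℝ) ^ 4 * (((n : ℝ) - 1) * ((n : ℝ) ^ 4)⁻¹)) * (((n : ℝ) - 1) * ((n : ℝ) ^ 4)⁻¹) = (((n : ℝ) - 1) / n) ^ 2 := by
      field_simp
    rw [e, sq_le_one_iff₀ (div_nonneg (by linarith) hn.le)]
    exact (div_le_one hn).2 (by linarith)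
  have hX : 0 ≤ ((n : ℝ) ^ 8)⁻¹ * (cG 4 a * (cG 4 a + cNear a) * ((1 + 4 / deltaU 4 a) ^ 2 * latticeConst 4 (deltaU 4 a / 2))) := by positivity
  calc ((n : ℝ) ^ 8)⁻¹ * (cG 4 a * ((n : ℝ) ^ 2 * ((1 + 4 / deltaU 4 a) ^ 2 *
          ((((n : ℝ) ^ 4 * (((n : ℝ) - 1) * ((n : ℝ) ^ 4)⁻¹)) * (cG 4 a + cNear a)) * latticeConst 4 (deltaU 4 a / 2))))) *
            (((n : ℝ) - 1) * ((n : ℝ) ^ 4)⁻¹)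
      = ((n : ℝ) ^ 8)⁻¹ * (cG 4 a * (cG 4 a + cNear a) * ((1 + 4 / deltaU 4 a) ^ 2 * latticeConst 4 (deltaU 4 a / 2))) *
          ((n : ℝ) ^ 2 * ((n : ℝ) ^ 4 * (((n : ℝ) - 1) * ((n : ℝ) ^ 4)⁻¹)) * (((n : ℝ) - 1) * ((n : ℝ) ^ 4)⁻¹)) := by ring
    _ ≤ ((n : ℝ) ^ 8)⁻¹ * (cG 4 a * (cG 4 a + cNear a) * ((1 + 4 / deltaU 4 a) ^ 2 * latticeConst 4 (deltaU 4 a / 2))) * 1 :=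
        mul_le_mul_of_nonneg_left hPQ hX
    _ = _ := mul_one _

/-! ## §4 In the glue's currency: `h₆` from ONE units line, tolerance `n⁸` -/

section Glue

variable {a : ℝ} {ωgh cQ : ℕ → ℝ} {k : ℝ}

/-- [folklore] **«T₆-ii ROW»: THE GHOST BUBBLE ROW `h₆` (`qA ⊗ qA` over `Ggh`) OF THE NEEDLE GROUP MODULO THE UNITS LINE WITH TOLERANCE n⁸** —
`(ha : 0 < a) (hk : ∀ n ≥ 2, |ωgh n·(cQ n·cQ n)| ≤ k·n⁸)` ⊢ `h₆` of `NeedleRowGlue.abs_gN_row_le_of_tables` VERBATIM (the conclusion shape of the record's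
`NeedleGhostBubble2Row.h₆_of_scaling`, which needs `k·n⁴`), with the explicit n-FREE constant
`C₆ := k·(cG 4 a·(cG 4 a + cNear a)·((1 + 4∕deltaU 4 a)²·latticeConst 4 (deltaU 4 a∕2)))`.  END-AGNOSTIC: under reading (ii) ∕ ENDₛ the letter is `|ωgh·cQ²| = 4N²a²·n⁸`,
so `k := 4N²a²` — ruled nowhere in this file. -/
theorem h₆_of_scaling₈ (ha : 0 < a) (hk : ∀ n : ℕ, 2 ≤ n → |ωgh n * (cQ n * cQ n)| ≤ k * (n : ℝ) ^ 8) (μ ν : Fin 4) :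
    ∀ n : ℕ, 2 ≤ n → ∀ [NeZero n], |ωgh n * (cQ n * cQ n) * ∑ b ∈ (univ : Finset (Fin 4 → Fin n)).image resSite, ((n : ℝ) ^ 4)⁻¹ *
      (((n : ℝ) ^ 8)⁻¹ * fullSum (fun w : Pt => toReal w μ * toReal w ν *
        biBubbleTable (Ggh n a) (Ggh n a) (qAntiAt (ctrHalf n) n) (qAntiAt (ctrHalf n) n) μ ν (b + w) b))|
        ≤ k * (cG 4 a * (cG 4 a + cNear a) * ((1 + 4 / deltaU 4 a) ^ 2 * latticeConst 4 (deltaU 4 a / 2))) := by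
  intro n hn _
  have hn0 : (0 : ℝ) < n := by exact_mod_cast (show 0 < n by omega)
  have h1 := abs_row₆_le₈ n a ha (ωgh n * (cQ n * cQ n)) μ ν
  have hK : 0 ≤ cG 4 a * (cG 4 a + cNear a) * ((1 + 4 / deltaU 4 a) ^ 2 * latticeConst 4 (deltaU 4 a / 2)) := by
    have := (cG_pos 4 ha).le; have := cNear_nonneg ha; have := latticeConst_nonneg 4 (half_pos (deltaU_pos 4 ha)).le; positivity
  refine h1.trans ?_
  have h2 : |ωgh n * (cQ n * cQ n)| * ((n : ℝ) ^ 8)⁻¹ ≤ k := by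
    rw [← le_div_iff₀ (inv_pos.2 (pow_pos hn0 8)), div_inv_eq_mul]
    exact hk n hn
  calc |ωgh n * (cQ n * cQ n)| * (((n : ℝ) ^ 8)⁻¹ * (cG 4 a * (cG 4 a + cNear a) *
        ((1 + 4 / deltaU 4 a) ^ 2 * latticeConst 4 (deltaU 4 a / 2))))
      = (|ωgh n * (cQ n * cQ n)| * ((n : ℝ) ^ 8)⁻¹) * (cG 4 a * (cG 4 a + cNear a) *
        ((1 + 4 / deltaU 4 a) ^ 2 * latticeConst 4 (deltaU 4 a / 2))) := by ring
    _ ≤ _ := mul_le_mul_of_nonneg_right h2 hK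

end Glue

end Summit.QuantumFields.BalabanUV.Beta.D1BFx.NeedleGhostBubble2RowMass8

end
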